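import Summits.BirchSwinnertonDyer.Rank1Residual.ManinAdditive.CuspidalKummerUFamily
import Summits.BirchSwinnertonDyer.Rank1Residual.ManinAdditive.ShimuraLedger
import Summits.BirchSwinnertonDyer.BirchSwinnertonDyer.Theorems.ManinLocalTwoThreeDatumModelChange
import Literature.NumberTheory.EllipticCurves.CuspFormLFunctionLevelConductorProofs
import Literature.NumberTheory.EllipticCurves.ManinConstantClassCertificateTwist
import Literature.NumberTheory.EllipticCurves.AdditiveReductionSemistableModelProofs
import Literature.NumberTheory.EllipticCurves.RootNumberTwistProofs
import Literature.NumberTheory.EllipticCurves.GlobalMinimalModelProofs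
import HarnessLib

/-!
# an's `u`-family (E-an-50♯/50R, `IsUFamilyModel`) IS the Shimura-ledger blind family `E′_u = blindCurve u`
# up to an integral translation; E-an-50R `UFamilyManinOdd` ⟺ E-an-69 `ManinOddBlindFamily` BY NAME
# (route `ManinLocalTwoThree`, crux C2 `ManinOddAtFour` stmt-BirchSwinnertonDyer-22967, blind residual «Rb»; cell bsd-f2-manin,
# width seat p2 gen 13; bookkeeping between an g31's leaf `CuspidalKummerUFamily.lean` (typer p690768) and an g16's
# `ShimuraLedger.lean`)

The an lens filed the totally-blind residual of C2 twice: as E-an-69 `ShimuraLedger.ManinOddBlindFamily` (C2 for the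
explicit curves `blindCurve m = [0, −2m, 0, m² + 4, 0]`, an g16 MEMO-an §58) and as E-an-50R `CuspidalKummer.UFamilyManinOdd`
(C2 for every `u`-family model `y² = (x + u)(x² + 4)` translated by `s`, an g31 MEMO-an §74).  This file proves they are
the SAME statement over the tree:

* `smul_blindCurve_eq_of_isUFamilyModel` / `isUFamilyModel_iff_exists_eq_smul_blindCurve` — a `u`-family model with
  parameters `(u, s)` is EXACTLY the translate `(1, s + u, 0, 0) • blindCurve u` (`x ↦ x + s + u`), and conversely;
  `isUFamilyModel_blindCurve` (`s = −u`).
* `uFamilyManinOdd_of_maninOddBlindFamily : ManinOddBlindFamily → UFamilyManinOdd` — transport of the lattice-optimal datum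
  along the integral translation (the lead's `exists_modularParametrizationData_smul_of_u_eq_one`; global minimality is
  preserved, `isGloballyMinimal_smul_of_int`).
* `maninOddBlindFamily_of_uFamilyManinOdd : exists_isNewformOf → UFamilyManinOdd → ManinOddBlindFamily` — the level of a
  datum of `blindCurve m` is divisible by `4`: `blindCurve m` (when globally minimal) is ADDITIVE at `2`
  (`2 ∣ c₄ = 16(m² − 12)`, `2 ∣ Δ = −2⁸(m² + 4)²`, Silverman VII.5.1(c)), so `4 ∣ N(blindCurve m)`
  (`four_dvd_conductorNorm_blindCurve_of_isGloballyMinimal`, every `m`), and the level is the conductor granted the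
  Modularity binder `hnf` (Carayol, `IsNewformOf.level_eq_conductorNorm_of_exists_isNewformOf`).
* `uFamilyManinOdd_iff_maninOddBlindFamily (hnf)`, and the E-an-50 split re-keyed on E-an-69:
  `kummerBlindResidualOdd_of_family : TotallyBlindIsUFamily → ManinOddBlindFamily → KummerBlindResidualOdd`.

HONEST FRAMING: pure bookkeeping; E-an-69 = E-an-50R and E-an-50♯ stay OPEN; nothing about BSD or Manin's conjecture is
proved here; C2 stays OPEN.  [cite: SilvermanAEC2009, III.1 Table 3.1; VII.5 Prop. 5.1(c)]
-/

set_option autoImplicit false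
-- lint-debt: the directory name repeats the summit name (sibling precedent `ManinLocalTwoThreeDatumModelChange.lean`)
set_option linter.dupNamespace false

noncomputable section

open scoped Classical MatrixGroups ModularForm NumberField
open CongruenceSubgroup IsDedekindDomain Rat.HeightOneSpectrum WeierstrassCurve
  Literature.NumberTheory.EllipticCurves Literature.NumberTheory.EllipticCurves.ModularForms
  Summit.BirchSwinnertonDyer.Rank1Residual.ManinAdditive.CuspidalKummer
  Summit.BirchSwinnertonDyer.Rank1Residual.ManinAdditive.ShimuraLedger

namespace Summit.BirchSwinnertonDyer.BirchSwinnertonDyer.Theorems.ManinLocalTwoThree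

/-! ### §1 The `u`-family is the translate of `blindCurve u` -/

/-- The translate `x ↦ x + (s + u)` of `E′_u = blindCurve u` is the `u`-family model with parameters `(u, s)`:
`(1, s + u, 0, 0) • [0, −2u, 0, u² + 4, 0] = [0, 3s + u, 0, 3s² + 2su + 4, (s + u)(s² + 4)]`.
[cite: SilvermanAEC2009, III.1 Table 3.1] -/
theorem smul_blindCurve_eq (u s : ℤ) :
    (⟨1, ((s + u : ℤ) : ℚ), 0, 0⟩ : VariableChange ℚ) • blindCurve u =
      ⟨0, ((3 * s + u : ℤ) : ℚ), 0, ((3 * s ^ 2 + 2 * s * u + 4 : ℤ) : ℚ), (((s + u) * (s ^ 2 + 4) : ℤ) : ℚ)⟩ := by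
  ext
  · simp [variableChange_a₁, blindCurve]
  · simp only [variableChange_a₂, blindCurve]; push_cast; ring
  · simp [variableChange_a₃, blindCurve]
  · simp only [variableChange_a₄, blindCurve]; push_cast; ring
  · simp only [variableChange_a₆, blindCurve]; push_cast; ring

/-- A `u`-family model with parameters `(u, s)` IS the translate `(1, s + u, 0, 0) • blindCurve u`.
[cite: SilvermanAEC2009, III.1 Table 3.1] -/
theorem eq_smul_blindCurve_of_uFamily (W : WeierstrassCurve ℚ) {u s : ℤ} (h₁ : W.a₁ = 0) (h₃ : W.a₃ = 0)
    (h₂ : W.a₂ = (3 * s + u : ℤ)) (h₄ : W.a₄ = (3 * s ^ 2 + 2 * s * u + 4 : ℤ))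
    (h₆ : W.a₆ = ((s + u) * (s ^ 2 + 4) : ℤ)) :
    W = (⟨1, ((s + u : ℤ) : ℚ), 0, 0⟩ : VariableChange ℚ) • blindCurve u := by
  rw [smul_blindCurve_eq]
  ext <;> assumption

/-- Conversely, `blindCurve u` is the translate `(1, −(s + u), 0, 0) • W` of the `u`-family model `W`.
[cite: SilvermanAEC2009, III.1 Table 3.1] -/
theorem smul_eq_blindCurve_of_uFamily (W : WeierstrassCurve ℚ) {u s : ℤ} (h₁ : W.a₁ = 0) (h₃ : W.a₃ = 0)
    (h₂ : W.a₂ = (3 * s + u : ℤ)) (h₄ : W.a₄ = (3 * s ^ 2 + 2 * s * u + 4 : ℤ))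
    (h₆ : W.a₆ = ((s + u) * (s ^ 2 + 4) : ℤ)) :
    (⟨1, ((-(s + u) : ℤ) : ℚ), 0, 0⟩ : VariableChange ℚ) • W = blindCurve u := by
  rw [eq_smul_blindCurve_of_uFamily W h₁ h₃ h₂ h₄ h₆, ← mul_smul]
  have : ((⟨1, ((-(s + u) : ℤ) : ℚ), 0, 0⟩ : VariableChange ℚ) * ⟨1, ((s + u : ℤ) : ℚ), 0, 0⟩) = 1 := by
    rw [VariableChange.mul_def, VariableChange.one_def]
    push_cast
    ext <;> simp
  rw [this, one_smul]

/-- **`IsUFamilyModel W` ⟺ `W` is an integral translate of some `blindCurve u`.** [cite: SilvermanAEC2009, III.1 Table 3.1] -/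
theorem isUFamilyModel_iff_exists_eq_smul_blindCurve (W : WeierstrassCurve ℚ) :
    IsUFamilyModel W ↔ ∃ u r : ℤ, W = (⟨1, (r : ℚ), 0, 0⟩ : VariableChange ℚ) • blindCurve u := by
  constructor
  · rintro ⟨u, s, h₁, h₃, h₂, h₄, h₆⟩
    exact ⟨u, s + u, by exact_mod_cast eq_smul_blindCurve_of_uFamily W h₁ h₃ h₂ h₄ h₆⟩
  · rintro ⟨u, r, rfl⟩
    refine ⟨u, r - u, ?_, ?_, ?_, ?_, ?_⟩
    · simp [variableChange_a₁, blindCurve]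
    · simp [variableChange_a₃, blindCurve]
    · simp only [variableChange_a₂, blindCurve]; push_cast; ring
    · simp only [variableChange_a₄, blindCurve]; push_cast; ring
    · simp only [variableChange_a₆, blindCurve]; push_cast; ring

/-- `blindCurve m` itself is a `u`-family model (`u = m`, `s = −m`). [folklore] -/
theorem isUFamilyModel_blindCurve (m : ℤ) : IsUFamilyModel (blindCurve m) := by
  refine ⟨m, -m, rfl, rfl, ?_, ?_, ?_⟩
  · simp only [blindCurve]; push_cast; ring
  · simp only [blindCurve]; push_cast; ring
  · simp only [blindCurve]; push_cast; ring

/-! ### §2 Integral translations preserve global minimality -/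

/-- `(1, r, s, t) • W` is globally minimal when `W` is and `r, s, t ∈ ℤ` (each local minimality is preserved by a
`v`-integral change with `v`-unit `u`; integrality over `𝓞 ℚ` follows from local integrality).
[cite: SilvermanAEC2009, VII.1, Remark 1.1] -/
theorem isGloballyMinimal_smul_of_int (W : WeierstrassCurve ℚ) [hW : W.IsGloballyMinimal] (r s t : ℤ) :
    ((⟨1, (r : ℚ), (s : ℚ), (t : ℚ)⟩ : VariableChange ℚ) • W).IsGloballyMinimal := by
  have hval : ∀ (v : HeightOneSpectrum (𝓞 ℚ)) (n : ℤ), v.valuation ℚ (n : ℚ) ≤ 1 := fun v n => by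
    simpa using HeightOneSpectrum.valuation_le_one (K := ℚ) v (n : 𝓞 ℚ)
  have hmin : ∀ v : HeightOneSpectrum (𝓞 ℚ),
      ((((⟨1, (r : ℚ), (s : ℚ), (t : ℚ)⟩ : VariableChange ℚ) • W).baseChange (v.adicCompletion ℚ))).IsMinimal
        (v.adicCompletionIntegers ℚ) := fun v =>
    isMinimal_adicCompletion_smul (hW.isMinimal v) _ (by simp) (hval v r) (hval v s) (hval v t)
  exact ⟨isIntegral_ringOfIntegers_of_forall_isMinimalAt _ hmin, hmin⟩

/-! ### §3 E-an-69 ⟹ E-an-50R (transport of the optimal datum along the translation) -/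

/-- E-an-69 on any curve EQUAL to some `blindCurve m` (substitution helper). [folklore] -/
theorem not_two_dvd_maninConstant_of_eq_blindCurve (h69 : ManinOddBlindFamily) (V : WeierstrassCurve ℚ)
    [V.IsElliptic] [V.IsGloballyMinimal] (m : ℤ) (hV : V = blindCurve m) {N : ℕ} [NeZero N]
    (D : ModularParametrizationData V N) (hopt : ∀ z ∈ D.L.lattice, ∃ w ∈ periodLattice D.f, z = D.c * w) :
    ¬ (2 : ℤ) ∣ D.maninConstant := by
  subst hV
  exact h69 m D hopt

/-- **E-an-69 `ManinOddBlindFamily` ⟹ E-an-50R `UFamilyManinOdd`.**  A `u`-family model `W` is `(1, s+u, 0, 0) • E′_u`;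
translating back by the INTEGRAL change `(1, −(s+u), 0, 0)` keeps global minimality and carries the lattice-optimal datum
(same newform, Manin constant and Néron period pair), so C2 for `E′_u` gives C2 for `W`. [cite: SilvermanAEC2009, III.1 Table 3.1] -/
theorem uFamilyManinOdd_of_maninOddBlindFamily (h69 : ManinOddBlindFamily) : UFamilyManinOdd := by
  intro W _ _ N _ D hopt _h4 hW
  obtain ⟨u, s, h₁, h₃, h₂, h₄, h₆⟩ := hW
  set C : VariableChange ℚ := ⟨1, ((-(s + u) : ℤ) : ℚ), 0, 0⟩ with hC
  have hCW : C • W = blindCurve u := smul_eq_blindCurve_of_uFamily W h₁ h₃ h₂ h₄ h₆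
  haveI : (C • W).IsGloballyMinimal := by
    have := isGloballyMinimal_smul_of_int W (-(s + u)) 0 0
    simpa [hC] using this
  obtain ⟨D', hf, hc, hL, -⟩ := exists_modularParametrizationData_smul_of_u_eq_one W D C rfl
  have hopt' : ∀ z ∈ D'.L.lattice, ∃ w ∈ periodLattice D'.f, z = D'.c * w := by
    rw [hf, hc, hL]; exact hopt
  have h := not_two_dvd_maninConstant_of_eq_blindCurve h69 (C • W) u hCW D' hopt'
  change ¬ (2 : ℤ) ∣ D'.c at h
  change ¬ (2 : ℤ) ∣ D.c
  rwa [hc] at h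

/-! ### §4 E-an-50R ⟹ E-an-69 (the level of a datum of `blindCurve m` is divisible by `4`, given modularity) -/

/-- `Δ(blindCurve m) = −2⁸ (m² + 4)²`. [folklore] -/
theorem Δ_blindCurve (m : ℤ) : (blindCurve m).Δ = (((-256) * (m ^ 2 + 4) ^ 2 : ℤ) : ℚ) := by
  simp only [blindCurve, WeierstrassCurve.Δ, WeierstrassCurve.b₂, WeierstrassCurve.b₄, WeierstrassCurve.b₆,
    WeierstrassCurve.b₈]
  push_cast; ring

/-- `c₄(blindCurve m) = 16 (m² − 12)`. [folklore] -/
theorem c₄_blindCurve (m : ℤ) : (blindCurve m).c₄ = ((16 * (m ^ 2 - 12) : ℤ) : ℚ) := by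
  simp only [blindCurve, WeierstrassCurve.c₄, WeierstrassCurve.b₂, WeierstrassCurve.b₄]
  push_cast; ring

/-- **`blindCurve m`, when globally minimal, is ADDITIVE at `2`** (`2 ∣ Δ_min`, `2 ∣ c₄`; Silverman VII.5.1(c)), for every `m`.
[cite: SilvermanAEC2009, VII.5 Prop. 5.1(c)] -/
theorem hasAdditiveReductionAt_two_blindCurve (m : ℤ) [(blindCurve m).IsElliptic] [(blindCurve m).IsGloballyMinimal] :
    (blindCurve m).HasAdditiveReductionAt ((primesEquiv (R := 𝓞 ℚ)).symm ⟨2, Nat.prime_two⟩) := by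
  set v : HeightOneSpectrum (𝓞 ℚ) := (primesEquiv (R := 𝓞 ℚ)).symm ⟨2, Nat.prime_two⟩ with hv
  have hpv : ((primesEquiv v : ℕ) : ℤ) = 2 := by
    rw [hv, Equiv.apply_symm_apply]; rfl
  refine WeierstrassCurve.hasAdditiveReductionAt_of_dvd_of_dvd (blindCurve m) v ?_ ?_
  · rw [hpv]
    have hΔ : (minimalDiscriminantInt (blindCurve m) : ℚ) = (((-256) * (m ^ 2 + 4) ^ 2 : ℤ) : ℚ) := by
      rw [cast_minimalDiscriminantInt, Δ_blindCurve]
    rw [Int.cast_inj.mp hΔ]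
    exact ⟨-128 * (m ^ 2 + 4) ^ 2, by ring⟩
  · rw [hpv]
    have hc : ((integralModelInt (blindCurve m)).c₄ : ℚ) = ((16 * (m ^ 2 - 12) : ℤ) : ℚ) := by
      rw [← c₄_blindCurve]
      conv_rhs => rw [← map_integralModelInt (blindCurve m)]
      rw [map_c₄, eq_intCast]
    rw [Int.cast_inj.mp hc]
    exact ⟨8 * (m ^ 2 - 12), by ring⟩

/-- **`4 ∣ N(blindCurve m)`** for every `m` at which `blindCurve m` is a globally minimal elliptic curve
(`f₂ ≥ 2` iff additive, Silverman ATAEC IV.10.2(c)). [cite: Silverman1994, IV.10.2(c)] -/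
theorem four_dvd_conductorNorm_blindCurve_of_isGloballyMinimal (m : ℤ) [(blindCurve m).IsElliptic]
    [(blindCurve m).IsGloballyMinimal] : 4 ∣ (blindCurve m).conductorNorm ℤ := by
  set v : HeightOneSpectrum ℤ := (primesEquiv (R := ℤ)).symm ⟨2, Nat.prime_two⟩ with hv
  have hgen : natGenerator v = 2 :=
    Literature.NumberTheory.EllipticCurves.Rat.natGenerator_primesEquiv_symm ⟨2, Nat.prime_two⟩
  have haddZ : (blindCurve m).HasAdditiveReductionAt v :=
    ((blindCurve m).hasAdditiveReductionAt_int_iff_ringOfIntegers ⟨2, Nat.prime_two⟩).mpr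
      (hasAdditiveReductionAt_two_blindCurve m)
  have h := (natGenerator_sq_dvd_conductorNorm_iff v (blindCurve m)).mpr haddZ
  rw [hgen] at h
  simpa using h

/-- **E-an-50R `UFamilyManinOdd` ⟹ E-an-69 `ManinOddBlindFamily`, granted the Modularity binder `hnf`** (the level of a
datum is the conductor, Carayol; `blindCurve m` is a `u`-family model and `4 ∣ N(blindCurve m)`).
[cite: DiamondShurman2005, Thm. 8.8.1] -/
theorem maninOddBlindFamily_of_uFamilyManinOdd (hnf : exists_isNewformOf) (h50 : UFamilyManinOdd) :
    ManinOddBlindFamily := by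
  intro m _ _ N _ D hopt
  have hN : N = (blindCurve m).conductorNorm ℤ :=
    IsNewformOf.level_eq_conductorNorm_of_exists_isNewformOf hnf D.isNewformOf
  have h4 : 4 ∣ N := hN ▸ four_dvd_conductorNorm_blindCurve_of_isGloballyMinimal m
  exact h50 (blindCurve m) D hopt h4 (isUFamilyModel_blindCurve m)

/-- **E-an-50R ⟺ E-an-69 over the tree** (granted modularity for ⟹; ⟸ is unconditional). [folklore] -/
theorem uFamilyManinOdd_iff_maninOddBlindFamily (hnf : exists_isNewformOf) :
    UFamilyManinOdd ↔ ManinOddBlindFamily :=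
  ⟨maninOddBlindFamily_of_uFamilyManinOdd hnf, uFamilyManinOdd_of_maninOddBlindFamily⟩

/-- **E-an-50 `KummerBlindResidualOdd` ⟸ E-an-50♯ `TotallyBlindIsUFamily` ∧ E-an-69 `ManinOddBlindFamily`** — an's split
`kummerBlindResidualOdd_of` re-keyed on the g16 row. [folklore] -/
theorem kummerBlindResidualOdd_of_family (h50s : TotallyBlindIsUFamily) (h69 : ManinOddBlindFamily) :
    KummerBlindResidualOdd :=
  kummerBlindResidualOdd_of h50s (uFamilyManinOdd_of_maninOddBlindFamily h69)

end Summit.BirchSwinnertonDyer.BirchSwinnertonDyer.Theorems.ManinLocalTwoThree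

end
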